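import Summits.ResolutionOfSingularities.ResolutionOfSingularities.Theorems.FrobeniusLadderFInjectiveMacaulayficationFullLastCentreDefs
import HarnessLib

/-!
# K10 — THE LAST-CENTRE REDUCTION IN THE KERNEL: `σ_L` is the blow-up chart map, `σ_L(Disc_x P) = y_L⁶·Disc_x P′`, and
# `ρ′ ≤` (order at the drop point of the cone-initial part of the residual) — an INEQUALITY with no genericity

[OURS · L1 W4.5a · res-L1-w45a-lead-1 g16 · kernel brick K10 for crux `FInjectiveMacaulayfication` stmt-ResolutionOfSingularities-15315; companion of
`Cruxes/FInjectiveMacaulayfication/Lines/T-disc.md` §0.24 (c) and `Lines/T_canon_door.lean` (res-L1-w45a-plan-1 RULING R25.31 (4)); supports the crux, proves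
nothing of it; OURS counted 0; AI-written (AI review is weaker than expert review).]

THE STATEMENT (★★ `rho_le_axisOrd`). Let `S` be a stage (monic cubic `x³ + b₂x² + b₁x + b₀` over `k[y₁..y₄]`, exceptional letters `Exc`), `Z = V(x, y_n : n ∈ Nor)`
a coordinate centre with `L ∈ Nor`, `S′` the `y_L`-chart origin stage (`IsChart`: `σ_L(bᵢ) = y_L^{3−i} bᵢ′`, `Exc′ = Exc ∪ {L}`), `Disc_x P = y^α·N` and
`Disc_x P′ = y^{α′}·N′` the residual decompositions. Then for every `m`: if some monomial `y^e` of `N` of MINIMAL normal degree along `Z` has `|e| − e_L ≤ m`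
(`AxisOrdLE Nor L N m`), then `ord₀ N′ ≤ m` (`OrdLE N′ m`). No canonicity, no budget, no drop-point hypothesis, any field. In the language of the memo: the
residual order at a point created by blowing up `Z` in direction `L` is at most the order at that point of the cone-initial part `in_Z(N)` read in the `L`-chart —
`ρ′ ≤ ord_x(N|_Z)` when `ν = 0`, `ρ′ ≤ ord_x([L^ν]N)` when `ν ≥ 1` (R25.31 (4)), and for a point centre the LAW `ρ′ ≤ ρ` (`rho_le_rho_of_point`).
THE EXACT LAW (★★★ `residual_transport`, `ordLE_iff`; res-L1-w45a-plan-1 R25.41 (iii) after res-L1-w45a-tri-2 g23 evaluated the cone-initial cut at bed cʼs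
canonical surface centre Π₂ and found it lossy): the monomials of `N′` are EXACTLY the monomials of `N` re-graded — `e′ ∈ supp N′ ⟺ e′ + ν·ε_L = tau e`,
`e ∈ supp N` — hence `ord₀ N′ ≤ m ⟺ ∃ e ∈ supp N, (|e| − e_L) + (ndeg e − ν) ≤ m`: `ρ′ = min_e [(|e| − e_L) + (ndeg e − ν)] = ord_{x′}(σ_L N) − ν`, always an
equality. MECHANISM: `y^{τα}·σ_L(N) = y_L⁶·y^{α′}·N′` (discriminant transport), the EXPONENT IDENTITY `6ε_L + α′ = τα + ν·ε_L` (≥ since `N′` is prime to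
`Exc′ = Exc ∪ {L}`, ≤ since `N` is prime to `Exc` and has a monomial of normal degree `ν`), and `σ_L` injective on monomials. Exponent bookkeeping only; no named fact.
-/

-- single-problem summit: the doubled namespace component is forced
set_option linter.dupNamespace false

noncomputable section

open MvPolynomial Finsupp
open Summit.ResolutionOfSingularities.ResolutionOfSingularities.Theorems.FInjectiveMacaulayfication.LastCentreDefs

namespace Summit.ResolutionOfSingularities.ResolutionOfSingularities.Theorems.FInjectiveMacaulayfication.LastCentreAxisOrder

variable {k : Type} [Field k]

variable (Nor : Finset Letter) (L : Letter)

/-- Exponent bookkeeping for the last-centre law (`tau_apply`). [OURS · L1 W4.5a · plumbing] -/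
theorem tau_apply (e : Expo) : tau Nor L e = e + Finsupp.single L (norDeg (Nor.erase L) e) := rfl

/-- `tau` does not change the exponents of letters other than `L`. [plumbing] -/
theorem tau_apply_ne (e : Expo) {n : Letter} (hn : n ≠ L) : tau Nor L e n = e n := by
  simp [tau_apply, hn.symm]

/-- The `L`-exponent of `tau e` is the full normal degree `Σ_{n ∈ Nor} e_n` when `L ∈ Nor`. [plumbing] -/
theorem tau_apply_self (e : Expo) (hL : L ∈ Nor) : tau Nor L e L = norDeg Nor e := by
  simp only [tau_apply, Finsupp.coe_add, Pi.add_apply, Finsupp.single_eq_same, norDeg]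
  rw [← Finset.add_sum_erase Nor (fun n => e n) hL]

/-- `tau` is injective (the chart map is injective on monomials). [plumbing] -/
theorem tau_injective : Function.Injective (tau Nor L) := by
  intro a b h
  have hne : ∀ n, n ≠ L → a n = b n := fun n hn => by
    have := congrArg (fun f => f n) h
    simpa [tau_apply, hn.symm] using this
  ext n
  by_cases hn : n = L
  · subst hn
    have hs : norDeg (Nor.erase n) a = norDeg (Nor.erase n) b :=
      Finset.sum_congr rfl fun m hm => hne m (Finset.ne_of_mem_erase hm)
    have := congrArg (fun f => f n) h
    simp only [tau_apply, Finsupp.coe_add, Pi.add_apply, Finsupp.single_eq_same, hs] at this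
    omega
  · exact hne n hn

/-- Total degree of `tau e`: `|tau e| = |e| + Σ_{n ∈ Nor ∖ L} e_n`. [plumbing] -/
theorem tdeg_tau (e : Expo) : tdeg (tau Nor L e) = tdeg e + norDeg (Nor.erase L) e := by
  simp only [tdeg, tau_apply, Finsupp.coe_add, Pi.add_apply, Finset.sum_add_distrib]
  congr 1
  rw [Finset.sum_eq_single L (fun n _ hn => by simp [Ne.symm hn]) (by simp)]
  simp

/-- With `L ∈ Nor`: `|tau e| + e_L = |e| + Σ_{n∈Nor} e_n`. [plumbing] -/
theorem tdeg_tau_add (e : Expo) (hL : L ∈ Nor) : tdeg (tau Nor L e) + e L = tdeg e + norDeg Nor e := by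
  rw [tdeg_tau, norDeg, norDeg, ← Finset.add_sum_erase Nor (fun n => e n) hL]
  ring

/-- ★ The chart map on monomials: `σ_L(c·y^e) = c·y^{tau e}`. [OURS · L1 W4.5a] -/
theorem chartMap_monomial (e : Expo) (c : k) : chartMap Nor L (monomial e c) = monomial (tau Nor L e) c := by
  rw [chartMap, AddMonoidAlgebra.mapDomainRingHom_apply, ← single_eq_monomial, ← single_eq_monomial,
    AddMonoidAlgebra.mapDomain_single]

/-- ★ `σ_L` IS the blow-up chart substitution: `σ_L(y_n) = y_n·y_L` for `n ∈ Nor ∖ {L}` and `σ_L(y_n) = y_n` otherwise. [OURS · L1 W4.5a] -/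
theorem chartMap_X (n : Letter) :
    chartMap Nor L (X n : YPoly k) = if n ∈ Nor ∧ n ≠ L then X n * X L else X n := by
  have hX : ∀ m : Letter, (X m : YPoly k) = monomial (Finsupp.single m 1) 1 := fun m => rfl
  rw [hX n, chartMap_monomial, tau_apply]
  by_cases h : n ∈ Nor ∧ n ≠ L
  · rw [if_pos h]
    have : norDeg (Nor.erase L) (Finsupp.single n 1) = 1 := by
      rw [norDeg, Finset.sum_eq_single n (fun m _ hm => by simp [Ne.symm hm])
        (fun hn => absurd (Finset.mem_erase.mpr ⟨h.2, h.1⟩) hn)]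
      simp
    rw [this, hX L, monomial_mul, mul_one]
  · rw [if_neg h]
    have : norDeg (Nor.erase L) (Finsupp.single n 1) = 0 := by
      rw [norDeg]
      refine Finset.sum_eq_zero fun m hm => ?_
      rw [Finsupp.single_apply, if_neg]
      rintro rfl
      exact h ⟨Finset.mem_of_mem_erase hm, Finset.ne_of_mem_erase hm⟩
    rw [this, Finsupp.single_zero, add_zero]

/-- Coefficients under the chart map: `coeff (tau e) (σ_L G) = coeff e G`. [plumbing] -/
theorem coeff_tau_chartMap (G : YPoly k) (e : Expo) : coeff (tau Nor L e) (chartMap Nor L G) = coeff e G := by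
  rw [chartMap, AddMonoidAlgebra.mapDomainRingHom_apply]
  unfold MvPolynomial.coeff AddMonoidAlgebra.mapDomain
  rw [AddMonoidAlgebra.coeff_ofCoeff]
  exact Finsupp.mapDomain_apply (tau_injective Nor L) _ e

/-- Every monomial of `σ_L G` is `tau e` for a monomial `e` of `G`. [plumbing] -/
theorem exists_of_mem_support_chartMap (G : YPoly k) (e' : Expo) (he' : e' ∈ (chartMap Nor L G).support) :
    ∃ e ∈ G.support, e' = tau Nor L e := by
  classical
  rw [chartMap, AddMonoidAlgebra.mapDomainRingHom_apply] at he'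
  unfold MvPolynomial.support AddMonoidAlgebra.mapDomain at he'
  rw [AddMonoidAlgebra.coeff_ofCoeff] at he'
  obtain ⟨e, he, rfl⟩ := Finset.mem_image.mp (Finsupp.mapDomain_support he')
  exact ⟨e, he, rfl⟩

/-- `σ_L` commutes with the discriminant (it is a ring map). [plumbing] -/
theorem chartMap_disc (b₂ b₁ b₀ : YPoly k) :
    chartMap Nor L (disc b₂ b₁ b₀) = disc (chartMap Nor L b₂) (chartMap Nor L b₁) (chartMap Nor L b₀) := by
  simp only [disc, map_add, map_sub, map_mul, map_pow, map_ofNat]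

/-- Weighted homogeneity of degree 6 of the cubic discriminant: `disc(m·c₂, m²·c₁, m³·c₀) = m⁶·disc(c₂,c₁,c₀)`. [classical] -/
theorem disc_scale (m c₂ c₁ c₀ : YPoly k) : disc (m * c₂) (m ^ 2 * c₁) (m ^ 3 * c₀) = m ^ 6 * disc c₂ c₁ c₀ := by
  simp only [disc]; ring

variable {Nor L}

/-- ★ DISCRIMINANT TRANSPORT: along a chart, `σ_L(Disc_x P) = y_L⁶ · Disc_x P′`. [OURS · L1 W4.5a] -/
theorem disc_chart {S S' : Stage k} (h : IsChart S Nor L S') : chartMap Nor L S.D = X L ^ 6 * S'.D := by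
  rw [Stage.D, chartMap_disc, h.1, h.2.1, h.2.2.1, Stage.D, disc_scale]

/-- Support of a monomial multiple: if `coeff m (y^s · G) ≠ 0` then `s ≤ m` and `coeff (m − s) G ≠ 0`. [plumbing] -/
theorem le_and_coeff_of_coeff_monomial_mul {s m : Expo} {G : YPoly k} (h : coeff m (monomial s (1 : k) * G) ≠ 0) :
    s ≤ m ∧ coeff (m - s) G ≠ 0 := by
  rw [coeff_monomial_mul'] at h
  by_cases hs : s ≤ m
  · rw [if_pos hs, one_mul] at h; exact ⟨hs, h⟩
  · rw [if_neg hs] at h; exact absurd rfl h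

/-- `coeff (s + m) (y^s · G) = coeff m G`. [plumbing] -/
theorem coeff_add_monomial_mul (s m : Expo) (G : YPoly k) : coeff (s + m) (monomial s (1 : k) * G) = coeff m G := by
  rw [coeff_monomial_mul', if_pos le_self_add, one_mul, add_tsub_cancel_left]

/-- Exponent bookkeeping for the last-centre law (`tdeg_add`). [OURS · L1 W4.5a · plumbing] -/
theorem tdeg_add (a b : Expo) : tdeg (a + b) = tdeg a + tdeg b := by
  simp [tdeg, Finset.sum_add_distrib]

/-- Exponent bookkeeping for the last-centre law (`tdeg_mono`). [OURS · L1 W4.5a · plumbing] -/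
theorem tdeg_mono {a b : Expo} (h : a ≤ b) : tdeg a ≤ tdeg b :=
  Finset.sum_le_sum fun n _ => h n

/-- Exponent bookkeeping for the last-centre law (`tdeg_tsub`). [OURS · L1 W4.5a · plumbing] -/
theorem tdeg_tsub {a b : Expo} (h : a ≤ b) : tdeg (b - a) = tdeg b - tdeg a := by
  have : tdeg b = tdeg a + tdeg (b - a) := by rw [← tdeg_add, add_tsub_cancel_of_le h]
  omega

/-- ★★ THE [ELEM] REDUCTION (R25.31 (4), `T-disc` §0.24 (c)), kernel form, NO genericity: at the `y_L`-chart origin of the blow-up of a permissible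
coordinate centre `Z ∋ x` (ANY history, canonical or not, no budget, no drop condition), the residual order `ρ′ = ord₀ N′` of `Disc_x P′` is at most the order at
`x′` of the cone-initial part of `N`: `AxisOrdLE Nor L N m → OrdLE N′ m`. Mechanism: `y^{τα}·σ_L(N) = y_L⁶·y^{α′}·N′`, `σ_L` is injective on monomials, the
`y_L`-exponent of `σ_L(y^e)` is the normal degree of `e`, and `N′` is prime to the exceptional letters. [OURS · L1 W4.5a] -/
theorem rho_le_axisOrd {S S' : Stage k} {α α' : Expo} {N N' : YPoly k} (hL : L ∈ Nor)
    (hch : IsChart S Nor L S') (hN : IsResidual S.Exc S.D α N) (hN' : IsResidual S'.Exc S'.D α' N')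
    {m : ℕ} (hax : AxisOrdLE Nor L N m) : OrdLE N' m := by
  classical
  obtain ⟨hD, hαoff, hNres⟩ := hN
  obtain ⟨hD', hα'off, hN'res⟩ := hN'
  -- the support equation  y^A · σN = y^B · N′  with A = τα, B = 6ε_L + α′
  set A : Expo := tau Nor L α with hA
  set B : Expo := Finsupp.single L 6 + α' with hB
  have hEQ : monomial A (1 : k) * chartMap Nor L N = monomial B (1 : k) * N' := by
    have h1 : chartMap Nor L S.D = monomial A 1 * chartMap Nor L N := by
      rw [hD, map_mul, chartMap_monomial]
    have h2 : X L ^ 6 * S'.D = monomial B 1 * N' := by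
      rw [hD', ← mul_assoc, X_pow_eq_monomial, monomial_mul, one_mul]
    rw [← h1, ← h2, disc_chart hch]
  -- (a) coordinatewise A ≤ B, and at L with margin ν
  obtain ⟨e, he, hmin, hdeg⟩ := hax
  have hExc' : S'.Exc = insert L S.Exc := hch.2.2.2.1
  -- for every n ∈ Exc′ pick a monomial of N′ with zero n-exponent; it witnesses A n ≤ B n (+ν at L)
  have key : ∀ n ∈ S'.Exc, A n + (if n = L then norDeg Nor e else 0) ≤ B n := by
    intro n hn
    obtain ⟨e₀, he₀, he₀n⟩ := hN'res n hn
    have hc : coeff (B + e₀) (monomial A (1 : k) * chartMap Nor L N) ≠ 0 := by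
      rw [hEQ, coeff_add_monomial_mul]; exact MvPolynomial.mem_support_iff.mp he₀
    obtain ⟨hAle, hc2⟩ := le_and_coeff_of_coeff_monomial_mul hc
    obtain ⟨e₁, he₁, he₁eq⟩ := exists_of_mem_support_chartMap Nor L N _ (MvPolynomial.mem_support_iff.mpr hc2)
    have hcoord : (B + e₀) n = A n + tau Nor L e₁ n := by
      have := congrArg (fun f => f n) he₁eq
      simp only [Finsupp.coe_tsub, Pi.sub_apply] at this
      have hle : A n ≤ (B + e₀) n := hAle n
      omega
    by_cases hnL : n = L
    · subst hnL
      rw [if_pos rfl]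
      have h1 : tau Nor n e₁ n = norDeg Nor e₁ := tau_apply_self Nor n e₁ hL
      have h2 : norDeg Nor e ≤ norDeg Nor e₁ := hmin e₁ he₁
      have h3 : (B + e₀) n = B n + e₀ n := rfl
      omega
    · rw [if_neg hnL, add_zero]
      have h3 : (B + e₀) n = B n + e₀ n := rfl
      omega
  have hAB : ∀ n, A n + (if n = L then norDeg Nor e else 0) ≤ B n := by
    intro n
    by_cases hn : n ∈ S'.Exc
    · exact key n hn
    · -- n ∉ Exc′: then n ≠ L and n ∉ Exc, so A n = α n = 0
      have hnL : n ≠ L := by rintro rfl; exact hn (by rw [hExc']; exact Finset.mem_insert_self _ _)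
      have hnE : n ∉ S.Exc := fun h => hn (by rw [hExc']; exact Finset.mem_insert_of_mem h)
      rw [if_neg hnL, add_zero, hA, tau_apply_ne Nor L α hnL, hαoff n hnE]
      exact Nat.zero_le _
  have hsum : tdeg A + norDeg Nor e ≤ tdeg B := by
    have := Finset.sum_le_sum fun n (_ : n ∈ (Finset.univ : Finset Letter)) => hAB n
    rw [Finset.sum_add_distrib, Finset.sum_ite_eq' Finset.univ L, if_pos (Finset.mem_univ _)] at this
    exact this
  -- (b) the monomial A + τe of the left side gives a monomial e* of N′ with B + e* = A + τe
  have hc : coeff (A + tau Nor L e) (monomial B (1 : k) * N') ≠ 0 := by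
    rw [← hEQ, coeff_add_monomial_mul, coeff_tau_chartMap]; exact MvPolynomial.mem_support_iff.mp he
  obtain ⟨hBle, hc2⟩ := le_and_coeff_of_coeff_monomial_mul hc
  refine ⟨A + tau Nor L e - B, MvPolynomial.mem_support_iff.mpr hc2, ?_⟩
  rw [tdeg_tsub hBle, tdeg_add]
  have := tdeg_tau_add Nor L e hL
  omega

/-- ★★★ THE RESIDUAL TRANSPORT (exact, no genericity): along a chart of the blow-up of ANY permissible coordinate centre, the monomials of the new
residual `N′` are in BIJECTION with those of `N`: `e′ ∈ supp N′ ⟺ e′ + ν·ε_L = tau e` for some `e ∈ supp N`, where `ν` is the minimal normal degree of `N`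
along `Z` (so `N′ = σ_L(N)/y_L^ν` monomial by monomial, same coefficients — `σ_L` is injective on monomials, nothing cancels). Ingredients: the support
equation `y^{τα}·σ_L N = y_L⁶·y^{α′}·N′` (`disc_chart`) and the EXPONENT IDENTITY `6ε_L + α′ = τα + ν·ε_L` (≥ because `N′` is prime to `Exc′ = Exc ∪ {L}`,
≤ because `N` is prime to `Exc` and has a monomial of normal degree `ν`). [OURS · L1 W4.5a] -/
theorem residual_transport {S S' : Stage k} {α α' : Expo} {N N' : YPoly k} (hL : L ∈ Nor)
    (hch : IsChart S Nor L S') (hN : IsResidual S.Exc S.D α N) (hN' : IsResidual S'.Exc S'.D α' N')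
    {ν : ℕ} (hν₁ : ∃ e ∈ N.support, norDeg Nor e = ν) (hν₂ : ∀ e ∈ N.support, ν ≤ norDeg Nor e) (e' : Expo) :
    e' ∈ N'.support ↔ ∃ e ∈ N.support, e' + Finsupp.single L ν = tau Nor L e := by
  classical
  obtain ⟨hD, hαoff, hNres⟩ := hN
  obtain ⟨hD', hα'off, hN'res⟩ := hN'
  set A : Expo := tau Nor L α with hA
  set B : Expo := Finsupp.single L 6 + α' with hB
  have hEQ : monomial A (1 : k) * chartMap Nor L N = monomial B (1 : k) * N' := by
    have h1 : chartMap Nor L S.D = monomial A 1 * chartMap Nor L N := by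
      rw [hD, map_mul, chartMap_monomial]
    have h2 : X L ^ 6 * S'.D = monomial B 1 * N' := by
      rw [hD', ← mul_assoc, X_pow_eq_monomial, monomial_mul, one_mul]
    rw [← h1, ← h2, disc_chart hch]
  have hExc' : S'.Exc = insert L S.Exc := hch.2.2.2.1
  -- from a monomial e₀ of N′: A ≤ B + e₀ and B + e₀ − A = τ e₁ with e₁ ∈ supp N
  have fromN' : ∀ e₀ ∈ N'.support, A ≤ B + e₀ ∧ ∃ e₁ ∈ N.support, B + e₀ - A = tau Nor L e₁ := by
    intro e₀ he₀
    have hc : coeff (B + e₀) (monomial A (1 : k) * chartMap Nor L N) ≠ 0 := by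
      rw [hEQ, coeff_add_monomial_mul]; exact MvPolynomial.mem_support_iff.mp he₀
    obtain ⟨hAle, hc2⟩ := le_and_coeff_of_coeff_monomial_mul hc
    obtain ⟨e₁, he₁, he₁eq⟩ := exists_of_mem_support_chartMap Nor L N _ (MvPolynomial.mem_support_iff.mpr hc2)
    exact ⟨hAle, e₁, he₁, he₁eq⟩
  -- from a monomial e of N: B ≤ A + τ e and A + τ e − B ∈ supp N′
  have fromN : ∀ e ∈ N.support, B ≤ A + tau Nor L e ∧ A + tau Nor L e - B ∈ N'.support := by
    intro e he
    have hc : coeff (A + tau Nor L e) (monomial B (1 : k) * N') ≠ 0 := by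
      rw [← hEQ, coeff_add_monomial_mul, coeff_tau_chartMap]; exact MvPolynomial.mem_support_iff.mp he
    obtain ⟨hBle, hc2⟩ := le_and_coeff_of_coeff_monomial_mul hc
    exact ⟨hBle, MvPolynomial.mem_support_iff.mpr hc2⟩
  -- THE EXPONENT IDENTITY  B = A + ν ε_L
  have hBA : B = A + Finsupp.single L ν := by
    ext n
    simp only [Finsupp.coe_add, Pi.add_apply, Finsupp.single_apply]
    apply le_antisymm
    · -- B n ≤ A n + [L = n] ν
      by_cases hnL : L = n
      · subst hnL
        rw [if_pos rfl]
        obtain ⟨e₀, he₀, he₀ν⟩ := hν₁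
        have hle := (fromN e₀ he₀).1 L
        simp only [Finsupp.coe_add, Pi.add_apply, tau_apply_self Nor L e₀ hL] at hle
        omega
      · rw [if_neg hnL, add_zero]
        by_cases hn : n ∈ S.Exc
        · obtain ⟨e₁, he₁, he₁n⟩ := hNres n hn
          have hle := (fromN e₁ he₁).1 n
          simp only [Finsupp.coe_add, Pi.add_apply, tau_apply_ne Nor L e₁ (Ne.symm hnL), he₁n] at hle
          omega
        · have hn' : n ∉ S'.Exc := by
            rw [hExc', Finset.mem_insert]; rintro (h | h); exact hnL h.symm; exact hn h
          have : B n = 0 := by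
            rw [hB]
            simp only [Finsupp.coe_add, Pi.add_apply, Finsupp.single_apply, if_neg hnL, zero_add]
            exact hα'off n hn'
          omega
    · -- A n + [L = n] ν ≤ B n
      by_cases hn : n ∈ S'.Exc
      · obtain ⟨e₀, he₀, he₀n⟩ := hN'res n hn
        obtain ⟨hAle, e₁, he₁, heq⟩ := fromN' e₀ he₀
        have hcoord : B n + e₀ n = A n + tau Nor L e₁ n := by
          have h1 := congrArg (fun f => f n) heq
          simp only [Finsupp.coe_tsub, Pi.sub_apply, Finsupp.coe_add, Pi.add_apply] at h1
          have h2 : A n ≤ (B + e₀) n := hAle n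
          simp only [Finsupp.coe_add, Pi.add_apply] at h2
          omega
        by_cases hnL : L = n
        · subst hnL
          rw [if_pos rfl]
          have h1 : tau Nor L e₁ L = norDeg Nor e₁ := tau_apply_self Nor L e₁ hL
          have h2 : ν ≤ norDeg Nor e₁ := hν₂ e₁ he₁
          omega
        · rw [if_neg hnL, add_zero]
          have h1 : tau Nor L e₁ n = e₁ n := tau_apply_ne Nor L e₁ (Ne.symm hnL)
          omega
      · have hnL : L ≠ n := by rintro rfl; exact hn (by rw [hExc']; exact Finset.mem_insert_self _ _)
        have hnE : n ∉ S.Exc := fun h => hn (by rw [hExc']; exact Finset.mem_insert_of_mem h)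
        rw [if_neg hnL, add_zero, hA, tau_apply_ne Nor L α (Ne.symm hnL), hαoff n hnE]
        exact Nat.zero_le _
  -- the bijection
  constructor
  · intro he'
    obtain ⟨hAle, e₁, he₁, heq⟩ := fromN' e' he'
    refine ⟨e₁, he₁, ?_⟩
    rw [← heq, hBA, add_assoc, add_tsub_cancel_left, add_comm]
  · rintro ⟨e, he, heq⟩
    obtain ⟨hBle, hmem⟩ := fromN e he
    have : A + tau Nor L e - B = e' := by
      rw [← heq, hBA]
      ext n
      simp only [Finsupp.coe_tsub, Finsupp.coe_add, Pi.sub_apply, Pi.add_apply]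
      omega
    rwa [this] at hmem

/-- ★★★ THE EXACT ONE-STEP LAW (answers R25.41 (iii) «state when it is an equality»: ALWAYS): `ord₀ N′ ≤ m ⟺` some monomial `y^e` of `N` has
`(|e| − e_L) + (ndeg_Z e − ν) ≤ m`, i.e. `ρ′ = min_{e ∈ supp N} [(|e| − e_L) + (ndeg_Z e − ν)] = ord_{x′}(σ_L N) − ν` — the new residual is the old one
RE-GRADED by the `L`-chart weight. The cone-initial cut `rho_le_axisOrd` keeps only the monomials with `ndeg = ν`; at bed cʼs canonical surface centre Π₂ the
minimum is realised one graded piece higher (`7t′³ỹ₃⁵`, `ndeg = ν + 1`, tri-2 R25.41), which is why the cone-initial cut (LC) of `Cruxes/…/Lines/T_canon_door.lean` v3 is refuted as a door (v4 records it). [OURS · L1 W4.5a] -/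
theorem ordLE_iff {S S' : Stage k} {α α' : Expo} {N N' : YPoly k} (hL : L ∈ Nor)
    (hch : IsChart S Nor L S') (hN : IsResidual S.Exc S.D α N) (hN' : IsResidual S'.Exc S'.D α' N')
    {ν : ℕ} (hν₁ : ∃ e ∈ N.support, norDeg Nor e = ν) (hν₂ : ∀ e ∈ N.support, ν ≤ norDeg Nor e) (m : ℕ) :
    OrdLE N' m ↔ ∃ e ∈ N.support, tdeg e + norDeg Nor e ≤ m + e L + ν := by
  constructor
  · rintro ⟨e', he', hdeg⟩
    obtain ⟨e, he, heq⟩ := (residual_transport hL hch hN hN' hν₁ hν₂ e').mp he'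
    refine ⟨e, he, ?_⟩
    have h1 := tdeg_tau_add Nor L e hL
    have h2 : tdeg e' + ν = tdeg (tau Nor L e) := by
      rw [← heq, tdeg_add]; simp [tdeg]
    omega
  · rintro ⟨e, he, hdeg⟩
    have hνle : Finsupp.single L ν ≤ tau Nor L e := by
      intro n
      by_cases hn : L = n
      · subst hn; rw [Finsupp.single_eq_same, tau_apply_self Nor L e hL]; exact hν₂ e he
      · rw [Finsupp.single_apply, if_neg hn]; exact Nat.zero_le _
    refine ⟨tau Nor L e - Finsupp.single L ν, (residual_transport hL hch hN hN' hν₁ hν₂ _).mpr ⟨e, he, tsub_add_cancel_of_le hνle⟩, ?_⟩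
    have h1 := tdeg_tau_add Nor L e hL
    have h2 : tdeg (tau Nor L e - Finsupp.single L ν) = tdeg (tau Nor L e) - ν := by
      rw [tdeg_tsub hνle]; simp [tdeg]
    omega

/-- COROLLARY (point centre, `Nor = univ`): THE LAW AT A POINT STEP `ρ′ ≤ ρ` — the residual order never increases under a point blow-up, at every chart
origin (kernel form of `T-disc` §0.17 point monotonicity; no budget, no canonicity). [OURS · L1 W4.5a] -/
theorem rho_le_rho_of_point {S S' : Stage k} {α α' : Expo} {N N' : YPoly k} {L : Letter}
    (hch : IsChart S Finset.univ L S') (hN : IsResidual S.Exc S.D α N) (hN' : IsResidual S'.Exc S'.D α' N')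
    {m : ℕ} (hρ : OrdLE N m) : OrdLE N' m := by
  classical
  -- a monomial of N of minimal total degree has minimal normal degree (Nor = univ) and |e| − e_L ≤ |e| ≤ m
  obtain ⟨e₀, he₀, hdeg₀⟩ := hρ
  obtain ⟨e, he, hmin⟩ := Finset.exists_min_image N.support tdeg ⟨e₀, he₀⟩
  refine rho_le_axisOrd (Nor := Finset.univ) (Finset.mem_univ L) hch hN hN' ⟨e, he, ?_, ?_⟩
  · intro e₁ he₁
    have h1 : norDeg Finset.univ e = tdeg e := rfl
    have h2 : norDeg Finset.univ e₁ = tdeg e₁ := rfl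
    rw [h1, h2]; exact hmin e₁ he₁
  · have := hmin e₀ he₀; omega

end Summit.ResolutionOfSingularities.ResolutionOfSingularities.Theorems.FInjectiveMacaulayfication.LastCentreAxisOrder

end
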